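import Summits.KontsevichZagierPeriods.KontsevichZagierPeriods.Theses.IsogenyCertificates
import Literature.NumberTheory.Transcendental.KZCalculus
import Literature.NumberTheory.EllipticCurves.RealLatticePeriod
import Literature.NumberTheory.EllipticCurves.RealLatticePeriodProofs
import Literature.NumberTheory.EllipticCurves.UniformizationProofs
import Literature.NumberTheory.EllipticCurves.UniformizationUniqueProofs
import Summits.KontsevichZagierPeriods.KontsevichZagierPeriods.Theorems.RealPeriodSectorComplete.Negative.Data

/-!
# Crux `RealPeriodSectorComplete` (stmt-KontsevichZagierPeriods-5381), line `period-ratio-branch-cov` — stub `stub_realPeriodLattice`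

For a nonsingular integral cubic `P(x) = x³ + Ax + B` (`4A³ + 27B² ≠ 0`) with largest real root
`e` (hypotheses: `P(e) = 0` and `P > 0` on `(e, ∞)`) and a KZ integral representation
`r₁ = [(e, ∞), c/√P]` (`c ∈ ℚ`), the **real period lattice** `Λ` of `y² = P(x)`: the lattice with
invariants `g₂(Λ) = −4A`, `g₃(Λ) = −4B` (so that `4x³ − g₂x − g₃ = 4P(x)`), which exists by the
Uniformization Theorem (`PeriodPair.uniformization_holds`) and is real because its invariants are
(`PeriodPair.isReal_of_g₂_g₃_real` + `PeriodPair.uniformization_unique_holds`).  Its Weierstrass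
function satisfies `℘_Λ(Ω₀/2) = e` (`Ω₀` the least positive real period): `e₁ = ℘(Ω₀/2)` is a root
of `4P` (`℘'(Ω₀/2) = 0` and `℘'² = 4℘³ − g₂℘ − g₃`) with `P > 0` on `(e₁, ∞) = ℘((0, Ω₀/2))`
(`℘' < 0` there), and two roots of `P` each with `P > 0` to their right coincide.  Finally
`value r₁ = ∫_{e}^{∞} c dx/√P(x) = 2c ∫_{e₁}^{∞} dx/√(4x³ − g₂x − g₃) = c · Ω₀` by Lawden's
half-period integral (`PeriodPair.IsReal.integral_Ioi_inv_sqrt_cubic_eq`), after transporting the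
integral from `ℝ¹` to `ℝ` along `MeasurableEquiv.funUnique (Fin 1) ℝ`.

All inputs are proved tree API (no named facts are taken as hypotheses).

## References

* D. F. Lawden, *Elliptic Functions and Applications*, Springer 1989, §6.11, (6.12.4), §6.15,
  (6.17.4).
* J. H. Silverman, *The Arithmetic of Elliptic Curves*, 2nd ed., Thm. VI.5.1.
* M. Kontsevich, D. Zagier, *Periods* (2001), §1.1–§1.2.
-/

noncomputable section

open MeasureTheory Set Filter
open scoped PeriodPair
open Literature.ModelTheory.ExponentialFields (IsSemialgebraic isSemialgebraic_setOf_eval_eq_zero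
  isSemialgebraic_setOf_eval_pos)
open Literature.NumberTheory.Transcendental
open Literature.NumberTheory.Transcendental.KZ

namespace Summit.KontsevichZagierPeriods.IsogenyCertificates.RealPeriodSectorCompleteStubs.RealPeriodLattice

/-! ### The real lattice with invariants `g₂ = −4A`, `g₃ = −4B` -/

/-- `(−4A)³ − 27(−4B)² = −16(4A³ + 27B²) ≠ 0`: the modular discriminant condition for the
invariants `(−4A, −4B)`. [folklore] -/
lemma discr_ne_zero {A B : ℤ} (h : 4 * A ^ 3 + 27 * B ^ 2 ≠ 0) :
    (-4 * (A : ℂ)) ^ 3 - 27 * (-4 * (B : ℂ)) ^ 2 ≠ 0 := by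
  have h' : ((4 * A ^ 3 + 27 * B ^ 2 : ℤ) : ℂ) ≠ 0 := by exact_mod_cast h
  intro h0
  apply h'
  push_cast
  linear_combination (-1 / 16 : ℂ) * h0

/-- Existence of the real period lattice of `y² = x³ + Ax + B`: a real lattice with
`g₂ = −4A`, `g₃ = −4B` (Uniformization Theorem, Silverman AEC VI.5.1, both halves). [folklore] -/
lemma exists_isReal {A B : ℤ} (h : 4 * A ^ 3 + 27 * B ^ 2 ≠ 0) :
    ∃ L : PeriodPair, L.IsReal ∧ L.g₂ = -4 * (A : ℂ) ∧ L.g₃ = -4 * (B : ℂ) := by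
  obtain ⟨L, h₂, h₃⟩ := PeriodPair.uniformization_holds _ _ (discr_ne_zero h)
  refine ⟨L, PeriodPair.isReal_of_g₂_g₃_real PeriodPair.uniformization_unique_holds ?_ ?_, h₂, h₃⟩
  · rw [h₂]; simp
  · rw [h₃]; simp

variable {L : PeriodPair}

/-- `re g₂ = −4A`. [folklore] -/
lemma g₂_re {A : ℤ} (h₂ : L.g₂ = -4 * (A : ℂ)) : L.g₂.re = -4 * (A : ℝ) := by
  rw [h₂]; simp

/-- `re g₃ = −4B`. [folklore] -/
lemma g₃_re {B : ℤ} (h₃ : L.g₃ = -4 * (B : ℂ)) : L.g₃.re = -4 * (B : ℝ) := by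
  rw [h₃]; simp

/-- `4x³ − g₂x − g₃ = 4P(x)` for the real period lattice of `y² = P(x)`. [folklore] -/
lemma cubic_eq {A B : ℤ} (h₂ : L.g₂ = -4 * (A : ℂ)) (h₃ : L.g₃ = -4 * (B : ℂ)) (x : ℝ) :
    4 * x ^ 3 - L.g₂.re * x - L.g₃.re = 4 * (x ^ 3 + (A : ℝ) * x + (B : ℝ)) := by
  rw [g₂_re h₂, g₃_re h₃]; ring

/-! ### `e₁ = ℘(Ω₀/2)` is the largest real root of `P` -/

/-- `e₁ = ℘(Ω₀/2)` is a root of `P`: `℘'(Ω₀/2) = 0` and `℘'² = 4℘³ − g₂℘ − g₃ = 4P(℘)`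
(Lawden §6.7, §6.11). [folklore] -/
lemma cubic_weierstrassPRe_half (hL : L.IsReal) {A B : ℤ} (h₂ : L.g₂ = -4 * (A : ℂ))
    (h₃ : L.g₃ = -4 * (B : ℂ)) :
    L.weierstrassPRe (L.minRealPeriod / 2) ^ 3 + (A : ℝ) * L.weierstrassPRe (L.minRealPeriod / 2) +
      (B : ℝ) = 0 := by
  have hΩ := hL.minRealPeriod_pos
  have hnot : ((L.minRealPeriod / 2 : ℝ) : ℂ) ∉ L.lattice :=
    hL.ofReal_notMem_lattice (by linarith) (by linarith)
  have hsq := hL.derivWeierstrassPRe_sq hnot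
  have h0 : L.derivWeierstrassPRe (L.minRealPeriod / 2) = 0 := by
    rw [PeriodPair.derivWeierstrassPRe_def, hL.derivWeierstrassP_minRealPeriod_div_two,
      Complex.zero_re]
  rw [h0, cubic_eq h₂ h₃] at hsq
  nlinarith [hsq]

/-- `P > 0` on `(e₁, ∞)`: every `x > e₁` is `℘(t)` for some `t ∈ (0, Ω₀/2)`, where
`4P(℘(t)) = ℘'(t)² > 0` since `℘' < 0` there (Lawden §6.11, §6.15). [folklore] -/
lemma cubic_pos_of_lt (hL : L.IsReal) {A B : ℤ} (h₂ : L.g₂ = -4 * (A : ℂ))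
    (h₃ : L.g₃ = -4 * (B : ℂ)) {x : ℝ} (hx : L.weierstrassPRe (L.minRealPeriod / 2) < x) :
    0 < x ^ 3 + (A : ℝ) * x + (B : ℝ) := by
  have hΩ := hL.minRealPeriod_pos
  have hx' : x ∈ L.weierstrassPRe '' Ioo 0 (L.minRealPeriod / 2) := by
    rw [hL.image_weierstrassPRe_Ioo]; exact hx
  obtain ⟨t, ht, rfl⟩ := hx'
  have hnot : (t : ℂ) ∉ L.lattice := hL.ofReal_notMem_lattice ht.1 (by linarith [ht.2])
  have hsq := hL.derivWeierstrassPRe_sq hnot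
  have hneg := hL.derivWeierstrassPRe_neg ht.1 ht.2
  rw [cubic_eq h₂ h₃] at hsq
  nlinarith [sq_pos_of_neg hneg, hsq]

/-- Two real roots of `P`, each with `P > 0` to its right, are equal. [folklore] -/
lemma root_unique {A B : ℤ} {e e' : ℝ} (he : e ^ 3 + (A : ℝ) * e + (B : ℝ) = 0)
    (hpos : ∀ x : ℝ, e < x → 0 < x ^ 3 + (A : ℝ) * x + (B : ℝ))
    (he' : e' ^ 3 + (A : ℝ) * e' + (B : ℝ) = 0)
    (hpos' : ∀ x : ℝ, e' < x → 0 < x ^ 3 + (A : ℝ) * x + (B : ℝ)) : e' = e := by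
  rcases lt_trichotomy e e' with h | h | h
  · exact absurd he' (hpos e' h).ne'
  · exact h.symm
  · exact absurd he (hpos' e h).ne'

/-! ### The value: `∫_{e₁}^{∞} dx/√P(x) = Ω₀` -/

/-- Lawden's half-period integral for the real period lattice of `y² = P(x)`:
`∫_{e₁}^{∞} dx/√P(x) = Ω₀` (from `∫_{e₁}^{∞} dx/√(4P(x)) = Ω₀/2`, Lawden (6.12.4), (6.17.4)).
[folklore] -/
lemma integral_Ioi_inv_sqrt_cubic (hL : L.IsReal) {A B : ℤ} (h₂ : L.g₂ = -4 * (A : ℂ))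
    (h₃ : L.g₃ = -4 * (B : ℂ)) :
    ∫ x in Ioi (L.weierstrassPRe (L.minRealPeriod / 2)),
        (Real.sqrt (x ^ 3 + (A : ℝ) * x + (B : ℝ)))⁻¹ = L.minRealPeriod := by
  have h := hL.integral_Ioi_inv_sqrt_cubic_eq
  have hfun : (fun x : ℝ => (Real.sqrt (4 * x ^ 3 - L.g₂.re * x - L.g₃.re))⁻¹) =
      fun x => (1 / 2 : ℝ) * (Real.sqrt (x ^ 3 + (A : ℝ) * x + (B : ℝ)))⁻¹ := by
    funext x
    have h4 : Real.sqrt 4 = 2 := by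
      rw [show (4 : ℝ) = 2 ^ 2 by norm_num]
      exact Real.sqrt_sq zero_le_two
    rw [cubic_eq h₂ h₃, Real.sqrt_mul (by norm_num : (0 : ℝ) ≤ 4), h4, mul_inv]
    norm_num
  rw [hfun, integral_const_mul] at h
  linarith

/-- `∫_{e₁}^{∞} c dx/√P(x) = c · Ω₀`. [folklore] -/
lemma integral_Ioi_const_div_sqrt_cubic (hL : L.IsReal) {A B : ℤ} (h₂ : L.g₂ = -4 * (A : ℂ))
    (h₃ : L.g₃ = -4 * (B : ℂ)) (c : ℝ) :
    ∫ x in Ioi (L.weierstrassPRe (L.minRealPeriod / 2)),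
        c / Real.sqrt (x ^ 3 + (A : ℝ) * x + (B : ℝ)) = c * L.minRealPeriod := by
  have h2 : ∫ x in Ioi (L.weierstrassPRe (L.minRealPeriod / 2)),
      c / Real.sqrt (x ^ 3 + (A : ℝ) * x + (B : ℝ)) =
      c * ∫ x in Ioi (L.weierstrassPRe (L.minRealPeriod / 2)),
        (Real.sqrt (x ^ 3 + (A : ℝ) * x + (B : ℝ)))⁻¹ := by
    rw [← integral_const_mul]
    simp_rw [div_eq_mul_inv]
  rw [h2, integral_Ioi_inv_sqrt_cubic hL h₂ h₃]

/-- Transport of an integral over the half-line `{x : ℝ¹ | e < x 0}` of `ℝ¹` to `(e, ∞) ⊆ ℝ`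
along the measure-preserving equivalence `ℝ¹ ≃ ℝ`, `x ↦ x 0` (`MeasurableEquiv.funUnique`).
[folklore] -/
lemma setIntegral_funUnique_Ioi (g : ℝ → ℝ) (e : ℝ) :
    ∫ x in {x : Fin 1 → ℝ | e < x 0}, g (x 0) = ∫ y in Ioi e, g y :=
  (volume_preserving_funUnique (Fin 1) ℝ).setIntegral_preimage_emb
    (MeasurableEquiv.measurableEmbedding _) g (Ioi e)

/-! ### The stub -/

/-- **Stub `stub_realPeriodLattice`** (real period lattice): for `P = x³ + Ax + B` nonsingular
over `ℤ` with largest real root `e` and `r₁ = [(e, ∞), c/√P]`, the real period lattice `Λ` of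
`y² = P` (invariants `g₂ = −4A`, `g₃ = −4B`) has `℘_Λ(Ω₀/2) = e` and `value r₁ = c · Ω₀`.
(Lawden §6.11–§6.17; Silverman AEC VI.5.1; Kontsevich–Zagier §1.1.) [folklore] -/
theorem stub_realPeriodLattice : ∀ (A B : ℤ), 4 * A ^ 3 + 27 * B ^ 2 ≠ 0 → ∀ (e : ℝ), e ^ 3 + (A : ℝ) * e + (B : ℝ) = 0 → (∀ x : ℝ, e < x → 0 < x ^ 3 + (A : ℝ) * x + (B : ℝ)) → ∀ (c : ℚ), 0 < c → ∀ (r₁ : IntegralRep 1), r₁.domain = {x | e < x 0} → EqOn r₁.integrand (fun x => (c : ℝ) / Real.sqrt (x 0 ^ 3 + (A : ℝ) * x 0 + (B : ℝ))) r₁.domain → ∃ L : PeriodPair, L.IsReal ∧ L.g₂ = -4 * (A : ℂ) ∧ L.g₃ = -4 * (B : ℂ) ∧ L.weierstrassPRe (L.minRealPeriod / 2) = e ∧ r₁.value = (c : ℝ) * L.minRealPeriod := by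
  intro A B hΔ e he hpos c _hc r₁ hd hi
  obtain ⟨L, hL, h₂, h₃⟩ := exists_isReal hΔ
  have heq : L.weierstrassPRe (L.minRealPeriod / 2) = e :=
    root_unique he hpos (cubic_weierstrassPRe_half hL h₂ h₃)
      (fun x hx => cubic_pos_of_lt hL h₂ h₃ hx)
  refine ⟨L, hL, h₂, h₃, heq, ?_⟩
  -- the value: replace the integrand by `c/√P` on the domain, transport to `ℝ`, use Lawden
  have hv : r₁.value =
      ∫ x in r₁.domain, (c : ℝ) / Real.sqrt (x 0 ^ 3 + (A : ℝ) * x 0 + (B : ℝ)) :=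
    setIntegral_congr_fun (IntegralRep.measurableSet_domain_holds r₁) hi
  rw [hv, hd, setIntegral_funUnique_Ioi
    (fun t : ℝ => (c : ℝ) / Real.sqrt (t ^ 3 + (A : ℝ) * t + (B : ℝ))) e, ← heq,
    integral_Ioi_const_div_sqrt_cubic hL h₂ h₃]

end Summit.KontsevichZagierPeriods.IsogenyCertificates.RealPeriodSectorCompleteStubs.RealPeriodLattice

end
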